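import Mathlib
import HarnessLib
import Summits.Ventures.LatticeQCDFlow.Scoring.GelmanRubin
import Summits.Ventures.LatticeQCDFlow.Scoring.FlowSamplerAutocorrelation
import Summits.Ventures.LatticeQCDFlow.Scoring.IndepMHKernelPositive

/-!
# The printed diagnostics of the exact flow sampler on `SU(n)^E` — UNCONDITIONAL: the naive error bar
# under-states the true error in expectation and is honest after the factor
# `(2e^{2δ} − 1)(N − 1)/(N + 1 − 2e^{2δ})`; the Gelman–Rubin pooled estimate of independent
# stationary streams is unbiased for `Var_π f`, with `E[B/N] ≤ (2e^{2δ} − 1) Var_π f/N`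

HONEST FRAMING: exact (Metropolis-corrected) sampling algorithms for lattice gauge theory;
figures of merit are autocorrelation/cost numbers at stated couplings and volumes; no
continuum-physics claim.

Venture `LatticeQCDFlow` (cell pub-lqcd), topic `Scoring`; FANOUT row 8 (`s0-cpn-nemc`, GEN-14).
NEW WORK of the cell, not a published result; no definition is introduced.  The composition of
`Scoring/NaiveErrorBar.lean` (`chain_naiveSEsq_le_variance_of_nonneg`,
`chain_variance_le_mul_naiveSEsq_of_doeblin`) and `Scoring/GelmanRubin.lean`
(`replicaChains_gelmanRubin_eq`, `replicaChains_between_le_of_doeblin`) with the tree's exact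
flow-MCMC theorem `Exactness.flowSampler_exact_doeblin` (row 30 / lean-2, UNCONDITIONAL via
`jacobianFormula_holds`: Doeblin constant `e^{−2δ}`) and the positivity of the flow-MCMC
autocovariances (`Scoring/IndepMHKernelPositive.indepMH_autocov_nonneg`).  Nothing is cited as a
fact.

## Content (hypotheses of `Scoring.flowSampler_autocorrelation`; `K = indepMH q w` EXACT for
## `π = 𝒵⁻¹e^{−S}D[U]`; `|f| ≤ C`; `Var_π f = autocov K π (f − πf) 0`; the STATIONARY run)

* **`flowSampler_naiveErrorBar`** — `N ≥ 2`: (i) `E[s²_N/N] ≤ Var[A_N]`; (ii) if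
  `2e^{2δ} − 1 < N`: `Var[A_N] ≤ ((2e^{2δ} − 1)(N − 1)/(N − (2e^{2δ} − 1))) · E[s²_N/N]`;
* **`flowSampler_gelmanRubin`** — `R ≥ 2` pairwise independent stationary streams on any
  probability space, `N ≥ 2`: `E[(N−1)W/N + B/N] = Var_π f` and `E[B/N] ≤ (2e^{2δ} − 1) Var_π f/N`.

Reading (value-free): for the exact flow sampler the iid error bar is never honest in expectation,
and a certified defect `δ` says by what factor to inflate it; the many-streams pooled variance is
exactly right in expectation and the between-stream excess that `R̂` reads is at most
`(2e^{2δ} − 1)/N` of `Var_π f`.  NOT CLAIMED: any value of `δ`; the scatter of these estimators;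
non-stationary starts.
-/

noncomputable section

namespace Summit.Ventures.LatticeQCDFlow.Scoring

open MeasureTheory ProbabilityTheory Filter Finset Summit.Ventures.LatticeQCDFlow.Exactness
open Literature.MathematicalPhysics.QuantumFieldTheory
open Literature.MathematicalPhysics.QuantumFieldTheory.Luscher2010
open Summit.Ventures.LatticeQCDFlow.TrivializingMaps
open scoped ENNReal Matrix Matrix.Norms.Frobenius ContDiff

variable {d L n : ℕ} [NeZero L]

/-- **The naive error bar of the exact flow sampler — UNCONDITIONAL.**  See the module docstring. -/
theorem flowSampler_naiveErrorBar (Bs : SuBasis n)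
    {S : AmbConfig d L n → ℝ} (hS : ContDiff ℝ ∞ S) {F : ℝ → AmbConfig d L n → ℝ}
    (hF : ContDiff ℝ ∞ fun p : ℝ × AmbConfig d L n => F p.1 p.2)
    {Φ : ℝ → GaugeConfig d L (Matrix.specialUnitaryGroup (Fin n) ℂ) →
      GaugeConfig d L (Matrix.specialUnitaryGroup (Fin n) ℂ)}
    (hΦ : IsFlowMap (fun t W => -linkGrad Bs (F t) W) Φ) {c : ℝ → ℝ} {δ : ℝ}
    (hδ : ∀ t ∈ Set.Icc (0 : ℝ) 1, ∀ U : GaugeConfig d L (Matrix.specialUnitaryGroup (Fin n) ℂ),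
      |luscherL Bs S t (F t) (WilsonFlow.coeConfig U) - S (WilsonFlow.coeConfig U) - c t| ≤ δ)
    (q : Measure (GaugeConfig d L (Matrix.specialUnitaryGroup (Fin n) ℂ))) [IsProbabilityMeasure q]
    (hq : q = Measure.map (Φ 1) (trivialMeasure (Matrix.specialUnitaryGroup (Fin n) ℂ) d L)) :
    ∃ w : GaugeConfig d L (Matrix.specialUnitaryGroup (Fin n) ℂ) → ℝ, ∃ hw : Measurable w,
      (q.withDensity fun U => ENNReal.ofReal (w U)) =
        boltzmannMeasure (fun U : GaugeConfig d L (Matrix.specialUnitaryGroup (Fin n) ℂ) =>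
          S (WilsonFlow.coeConfig U)) ∧
      Kernel.Invariant (indepMH q w)
        (boltzmannMeasure fun U : GaugeConfig d L (Matrix.specialUnitaryGroup (Fin n) ℂ) =>
          S (WilsonFlow.coeConfig U)) ∧
      ∀ (f : GaugeConfig d L (Matrix.specialUnitaryGroup (Fin n) ℂ) → ℝ), Measurable f →
        ∀ C : ℝ, (∀ U, |f U| ≤ C) → ∀ N : ℕ, 2 ≤ N →
        let π := boltzmannMeasure fun U : GaugeConfig d L (Matrix.specialUnitaryGroup (Fin n) ℂ) =>
          S (WilsonFlow.coeConfig U)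
        haveI : Fact (Measurable w) := ⟨hw⟩
        let P := Kernel.trajMeasure
          (X := fun _ : ℕ => GaugeConfig d L (Matrix.specialUnitaryGroup (Fin n) ℂ)) π
          (fun m : ℕ => (indepMH q w).comap
            (fun y : (i : ↥(Finset.Iic m)) → GaugeConfig d L (Matrix.specialUnitaryGroup (Fin n) ℂ) =>
              y ⟨m, Finset.mem_Iic.2 le_rfl⟩) (measurable_pi_apply _))
        ∫ x, replicaSEsq (fun i (x : ℕ → GaugeConfig d L (Matrix.specialUnitaryGroup (Fin n) ℂ)) =>
              f (x i)) N x ∂P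
            ≤ Var[fun x : ℕ → GaugeConfig d L (Matrix.specialUnitaryGroup (Fin n) ℂ) =>
                (∑ i ∈ range N, f (x i)) / N; P] ∧
          (2 * Real.exp (2 * δ) - 1 < N →
            Var[fun x : ℕ → GaugeConfig d L (Matrix.specialUnitaryGroup (Fin n) ℂ) =>
                (∑ i ∈ range N, f (x i)) / N; P]
              ≤ (2 * Real.exp (2 * δ) - 1) * (N - 1) / (N - (2 * Real.exp (2 * δ) - 1))
                * ∫ x, replicaSEsq
                    (fun i (x : ℕ → GaugeConfig d L (Matrix.specialUnitaryGroup (Fin n) ℂ)) => f (x i))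
                    N x ∂P) := by
  obtain ⟨w, hw, hlo, hhi, hπ, hinv, -, hdoeb⟩ := flowSampler_exact_doeblin Bs hS hF hΦ hδ q hq
  haveI : Fact (Measurable w) := ⟨hw⟩
  have hS'c : Continuous fun U : GaugeConfig d L (Matrix.specialUnitaryGroup (Fin n) ℂ) =>
      S (WilsonFlow.coeConfig U) := hS.continuous.comp WilsonFlow.continuous_coeConfig
  haveI := isProbabilityMeasure_boltzmannMeasure (d := d) (L := L) hS'c
  have hε0 : 0 < ENNReal.ofReal (Real.exp (-(2 * δ))) := ENNReal.ofReal_pos.2 (Real.exp_pos _)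
  have hr : (ENNReal.ofReal (Real.exp (-(2 * δ)))).toReal = Real.exp (-(2 * δ)) :=
    ENNReal.toReal_ofReal (Real.exp_pos _).le
  have hw0 : ∀ U, 0 < w U := fun U => (Real.exp_pos _).trans_le (hlo U)
  have hwi : Integrable w q :=
    integrable_of_bounded q hw (C := Real.exp (2 * δ)) fun U => by
      rw [abs_of_pos (hw0 U)]; exact hhi U
  have he2 : 2 / Real.exp (-(2 * δ)) = 2 * Real.exp (2 * δ) := by
    rw [Real.exp_neg, div_inv_eq_mul]
  refine ⟨w, hw, hπ, hinv, fun f hf C hC N hN => ⟨?_, fun hNd => ?_⟩⟩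
  · exact chain_naiveSEsq_le_variance_of_nonneg (κ := indepMH q w) hinv hf hC hN
      (indepMH_autocov_nonneg hw hw0 hwi hπ (hf.sub measurable_const)
        (C := C + |∫ V, f V ∂(boltzmannMeasure fun U : GaugeConfig d L
          (Matrix.specialUnitaryGroup (Fin n) ℂ) => S (WilsonFlow.coeConfig U))|)
        fun U => (abs_sub _ _).trans (add_le_add (hC U) le_rfl))
  · have hNd' : 2 / (ENNReal.ofReal (Real.exp (-(2 * δ)))).toReal - 1 < N := by
      rw [hr, he2]; exact hNd
    have h := chain_variance_le_mul_naiveSEsq_of_doeblin (κ := indepMH q w) hinv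
      (fun x A hA => hdoeb x hA) hε0 hf hC hN hNd'
    rw [hr, he2] at h
    exact h

/-- **The Gelman–Rubin statistic of independent flow-sampler streams — UNCONDITIONAL.**  See the
module docstring. -/
theorem flowSampler_gelmanRubin (Bs : SuBasis n)
    {S : AmbConfig d L n → ℝ} (hS : ContDiff ℝ ∞ S) {F : ℝ → AmbConfig d L n → ℝ}
    (hF : ContDiff ℝ ∞ fun p : ℝ × AmbConfig d L n => F p.1 p.2)
    {Φ : ℝ → GaugeConfig d L (Matrix.specialUnitaryGroup (Fin n) ℂ) →
      GaugeConfig d L (Matrix.specialUnitaryGroup (Fin n) ℂ)}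
    (hΦ : IsFlowMap (fun t W => -linkGrad Bs (F t) W) Φ) {c : ℝ → ℝ} {δ : ℝ}
    (hδ : ∀ t ∈ Set.Icc (0 : ℝ) 1, ∀ U : GaugeConfig d L (Matrix.specialUnitaryGroup (Fin n) ℂ),
      |luscherL Bs S t (F t) (WilsonFlow.coeConfig U) - S (WilsonFlow.coeConfig U) - c t| ≤ δ)
    (q : Measure (GaugeConfig d L (Matrix.specialUnitaryGroup (Fin n) ℂ))) [IsProbabilityMeasure q]
    (hq : q = Measure.map (Φ 1) (trivialMeasure (Matrix.specialUnitaryGroup (Fin n) ℂ) d L)) :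
    ∃ w : GaugeConfig d L (Matrix.specialUnitaryGroup (Fin n) ℂ) → ℝ, ∃ hw : Measurable w,
      (q.withDensity fun U => ENNReal.ofReal (w U)) =
        boltzmannMeasure (fun U : GaugeConfig d L (Matrix.specialUnitaryGroup (Fin n) ℂ) =>
          S (WilsonFlow.coeConfig U)) ∧
      Kernel.Invariant (indepMH q w)
        (boltzmannMeasure fun U : GaugeConfig d L (Matrix.specialUnitaryGroup (Fin n) ℂ) =>
          S (WilsonFlow.coeConfig U)) ∧
      ∀ {Ω' : Type*} [MeasurableSpace Ω'] (μ : Measure Ω') [IsProbabilityMeasure μ]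
        (X : ℕ → Ω' → (ℕ → GaugeConfig d L (Matrix.specialUnitaryGroup (Fin n) ℂ))) (R N : ℕ),
        2 ≤ R → 2 ≤ N → (∀ r, Measurable (X r)) →
        let π := boltzmannMeasure fun U : GaugeConfig d L (Matrix.specialUnitaryGroup (Fin n) ℂ) =>
          S (WilsonFlow.coeConfig U)
        haveI : Fact (Measurable w) := ⟨hw⟩
        (∀ r < R, μ.map (X r) = Kernel.trajMeasure
            (X := fun _ : ℕ => GaugeConfig d L (Matrix.specialUnitaryGroup (Fin n) ℂ)) π
            (fun j : ℕ => (indepMH q w).comap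
              (fun y : (i : ↥(Finset.Iic j)) → GaugeConfig d L (Matrix.specialUnitaryGroup (Fin n) ℂ) =>
                y ⟨j, Finset.mem_Iic.2 le_rfl⟩) (measurable_pi_apply _))) →
        (∀ i < R, ∀ j < R, i ≠ j → IndepFun (X i) (X j) μ) →
        ∀ (f : GaugeConfig d L (Matrix.specialUnitaryGroup (Fin n) ℂ) → ℝ), Measurable f →
          ∀ C : ℝ, (∀ U, |f U| ≤ C) →
          ((N : ℝ) - 1) * ∫ xs, (∑ r ∈ range R,
                replicaSEsq (fun i xs => f (X r xs i)) N xs) / R ∂μ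
              + R * ∫ xs, replicaSEsq (fun r xs => (∑ i ∈ range N, f (X r xs i)) / N) R xs ∂μ
            = autocov (indepMH q w) π (fun U => f U - ∫ V, f V ∂π) 0 ∧
          R * ∫ xs, replicaSEsq (fun r xs => (∑ i ∈ range N, f (X r xs i)) / N) R xs ∂μ
            ≤ (2 * Real.exp (2 * δ) - 1) * autocov (indepMH q w) π (fun U => f U - ∫ V, f V ∂π) 0
              / N := by
  obtain ⟨w, hw, -, -, hπ, hinv, -, hdoeb⟩ := flowSampler_exact_doeblin Bs hS hF hΦ hδ q hq
  haveI : Fact (Measurable w) := ⟨hw⟩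
  have hS'c : Continuous fun U : GaugeConfig d L (Matrix.specialUnitaryGroup (Fin n) ℂ) =>
      S (WilsonFlow.coeConfig U) := hS.continuous.comp WilsonFlow.continuous_coeConfig
  haveI := isProbabilityMeasure_boltzmannMeasure (d := d) (L := L) hS'c
  have hε0 : 0 < ENNReal.ofReal (Real.exp (-(2 * δ))) := ENNReal.ofReal_pos.2 (Real.exp_pos _)
  have hr : (ENNReal.ofReal (Real.exp (-(2 * δ)))).toReal = Real.exp (-(2 * δ)) :=
    ENNReal.toReal_ofReal (Real.exp_pos _).le
  have he2 : 2 / Real.exp (-(2 * δ)) = 2 * Real.exp (2 * δ) := by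
    rw [Real.exp_neg, div_inv_eq_mul]
  refine ⟨w, hw, hπ, hinv, fun μ _ X R N hR hN hXm hlaw hind f hf C hC => ⟨?_, ?_⟩⟩
  · exact replicaChains_gelmanRubin_eq (κ := indepMH q w) (μ := μ) (X := X) hinv hf hC hR hN hXm
      hlaw hind
  · have hN0 : N ≠ 0 := by omega
    have h := replicaChains_between_le_of_doeblin (κ := indepMH q w) (μ := μ) (X := X) hinv
      (fun x A hA => hdoeb x hA) hε0 hf hC hR hN0 hXm hlaw hind
    rw [hr, he2] at h
    exact h

end Summit.Ventures.LatticeQCDFlow.Scoring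

end
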